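import Summits.QuantumFields.YangMills.Theorems.UnitScaleTiltSmoothLiftInterpPlaq
import Summits.QuantumFields.YangMills.Theorems.UnitScaleTiltSmoothLiftFibre
import Summits.QuantumFields.YangMills.Theorems.UnitScaleTiltMinimiserStabilityRegPrAvgCurvGrad
import HarnessLib

/-!
# Route `UnitScaleTilt`, crux K1 child «MinimiserStabilityRegPr» (stmt-QuantumFields-19200), stub `stub_smoothLift` (G-K1a-2′) — helper P2d:
# CURVATURE GRADIENTS OF A FIELD WITH THE BLOCK STRUCTURE OF THE SMOOTH INTERPOLATION ARE `O(a² + b′ + defects)`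

Fleet seat `ym-ust-19200-p2` (gen 0).  Clause (iii) of `SmoothLiftAt` asks for the backward covariant derivatives of the plaquette
fields ([Balaban1985RegularSpaces] (1.1), tree `covDerivT 1 (unitsField (toUField U)) ν (plaqFT …)`; dictionary
`AvgCurvGrad.covDerivT_plaqFT_shift_eq(_inv)`) of the lift.  THIS FILE proves it for ANY fine `SU(2)` field `W` carrying the block
structure of the interpolation of a coarse field `V` (`UnitScaleTiltSmoothLiftInterpPlaq`):
  (S) `‖W(∂q) − exp(F_{κλ}(blockOf q₋)/L²)‖ ≤ K` for every fine plaquette `q`, and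
  (B) `‖W(b)·(faceSec V (b))* − 1‖ ≤ ε` for every fine bond `b` (the bond variables are the face section up to a factor near `1`),
together with `|F| ≤ 2a ≤ 1` and the covariant-constancy defect `‖V(y,κ)F(y+e_κ)V(y,κ)* − F(y)‖ ≤ b′` of `V`:
**`norm_covDerivT_plaqFT_le_of_structure`** — every curvature gradient of `W` is `≤ 2K + 8aε + 3b′`.  Transporting `exp(F(y)/L²)`
across a face conjugates it by `V(y,ν)`, which turns `F(y)` into `F(y + e_ν)` up to `b′`; inside a block nothing moves.  Both `interp V`
(`ε = 2da`, §2) and its exact correction on the central bonds (ε, K enlarged by the size of the correction) satisfy (S), (B).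
[cite: Balaban1985RegularSpaces, (1.1) p.76; King1986, (A.5) p.676]
-/

noncomputable section

open NormedSpace
open scoped Matrix.Norms.L2Operator BigOperators

namespace Summit.QuantumFields.YangMills.Theorems.SmoothLiftInterp

open Literature.MathematicalPhysics.QuantumFieldTheory.Balaban1983to89
open MatrixLog T4Continuum AveragingRT BlockAveraging BlockAveragingSection BlockAveragingSectionPlaq
open B10Eq27TorusAxialLog (toUField unitsField)
open B10Eq68TorusRegularity (plaqFT covDerivT)
open Summit.QuantumFields.YangMills.Theorems.AvgCurvGrad (covDerivT_plaqFT_shift_eq covDerivT_plaqFT_shift_eq_inv shift_unshift' covDiff_inv_le)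
open Summit.QuantumFields.YangMills.Theorems.SmoothLiftFibre (exp_sub_one_le_two_mul norm_coe_su2_le)

variable {P : Params} {j : ℕ}

/-- `‖G⁻¹ Y G − Y‖ ≤ 2‖Y − 1‖·‖G − 1‖` for `G ∈ SU(2)`: a transport near `1` moves an element near `1` at second order. [folklore] -/
theorem norm_inv_conj_sub_le (G : Matrix.specialUnitaryGroup (Fin 2) ℂ) (Y : Matrix (Fin 2) (Fin 2) ℂ) :
    ‖star ((G : Matrix.specialUnitaryGroup (Fin 2) ℂ) : Matrix (Fin 2) (Fin 2) ℂ) * Y * ((G : Matrix.specialUnitaryGroup (Fin 2) ℂ) : Matrix (Fin 2) (Fin 2) ℂ) - Y‖ ≤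
      2 * ‖Y - 1‖ * ‖((G : Matrix.specialUnitaryGroup (Fin 2) ℂ) : Matrix (Fin 2) (Fin 2) ℂ) - 1‖ := by
  set g : Matrix (Fin 2) (Fin 2) ℂ := ((G : Matrix.specialUnitaryGroup (Fin 2) ℂ) : Matrix (Fin 2) (Fin 2) ℂ) with hg
  have hgg : star g * g = 1 := Matrix.mem_unitaryGroup_iff'.1 (Matrix.mem_specialUnitaryGroup_iff.1 G.2).1
  have hid : star g * Y * g - Y = star g * ((Y - 1) * (g - 1) - (g - 1) * (Y - 1)) := by
    have : star g * Y * g - Y = star g * (Y * g) - (star g * g) * Y := by rw [hgg, one_mul, mul_assoc]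
    rw [this]; noncomm_ring
  rw [hid]
  have hsg : ‖star g‖ ≤ 1 := by rw [norm_star]; exact norm_coe_su2_le G
  calc ‖star g * ((Y - 1) * (g - 1) - (g - 1) * (Y - 1))‖ ≤ ‖star g‖ * ‖(Y - 1) * (g - 1) - (g - 1) * (Y - 1)‖ := norm_mul_le _ _
    _ ≤ 1 * (‖(Y - 1) * (g - 1)‖ + ‖(g - 1) * (Y - 1)‖) := by gcongr; exact norm_sub_le _ _
    _ ≤ 1 * (‖Y - 1‖ * ‖g - 1‖ + ‖g - 1‖ * ‖Y - 1‖) := by gcongr <;> exact norm_mul_le _ _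
    _ = 2 * ‖Y - 1‖ * ‖g - 1‖ := by ring

/-- **ONE COVARIANT DIFFERENCE FROM THE BLOCK STRUCTURE** (positive orientation `κ < κ′`):
`‖W(z,ν)⁻¹ W(∂p(z)) W(z,ν) − W(∂p(z+e_ν))‖ ≤ 2K + 8aε + 3b′` under (S), (B). [cite: Balaban1985RegularSpaces, (1.1) p.76] -/
theorem norm_covDiff_le_of_structure (hj : j + 1 ≤ P.m + P.K) (V : GaugeField P (j+1) (Matrix.specialUnitaryGroup (Fin 2) ℂ))
    (W : GaugeField P j (Matrix.specialUnitaryGroup (Fin 2) ℂ)) {a b' K ε : ℝ} (ha4 : a ≤ 1 / 4) (hK : 0 ≤ K) (hb' : 0 ≤ b')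
    (hc : ∀ (y : Site P (j+1)) (ρ μ : Fin P.d), ‖curv V y ρ μ‖ ≤ 2 * a)
    (hcc : ∀ (y : Site P (j+1)) (κ ρ μ : Fin P.d),
      ‖((V ⟨y, κ⟩ : Matrix.specialUnitaryGroup (Fin 2) ℂ) : Matrix (Fin 2) (Fin 2) ℂ) * curv V (y.shift κ) ρ μ *
          star ((V ⟨y, κ⟩ : Matrix.specialUnitaryGroup (Fin 2) ℂ) : Matrix (Fin 2) (Fin 2) ℂ) - curv V y ρ μ‖ ≤ b')
    (hS : ∀ q : Plaq P j, ‖((GaugeField.plaqHol W q : Matrix.specialUnitaryGroup (Fin 2) ℂ) : Matrix (Fin 2) (Fin 2) ℂ) -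
        exp ((1 / (P.L : ℝ) ^ 2) • curv V (blockOf q.src) q.μ q.ν)‖ ≤ K)
    (hB : ∀ b : PBond P j, ‖((W b : Matrix.specialUnitaryGroup (Fin 2) ℂ) : Matrix (Fin 2) (Fin 2) ℂ) *
        star ((faceSec V b : Matrix.specialUnitaryGroup (Fin 2) ℂ) : Matrix (Fin 2) (Fin 2) ℂ) - 1‖ ≤ ε)
    (z : Site P j) (ν : Fin P.d) {κ κ' : Fin P.d} (h : κ < κ') :
    ‖(((W ⟨z, ν⟩)⁻¹ * GaugeField.plaqHol W ⟨z, κ, κ', h⟩ * W ⟨z, ν⟩ : Matrix.specialUnitaryGroup (Fin 2) ℂ) : Matrix (Fin 2) (Fin 2) ℂ) -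
        ((GaugeField.plaqHol W ⟨z.shift ν, κ, κ', h⟩ : Matrix.specialUnitaryGroup (Fin 2) ℂ) : Matrix (Fin 2) (Fin 2) ℂ)‖ ≤
      2 * K + 8 * a * ε + 3 * b' := by
  letI : NormedAlgebra ℚ (Matrix (Fin 2) (Fin 2) ℂ) := NormedAlgebra.restrictScalars ℚ ℂ _
  have hL : (0 : ℝ) < P.L := Nat.cast_pos.mpr P.L_pos
  have hL1 : (1 : ℝ) ≤ P.L := by exact_mod_cast P.L_pos
  have ha : 0 ≤ a := by linarith [norm_nonneg (curv V (blockOf z) κ κ'), hc (blockOf z) κ κ']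
  -- names
  set y := blockOf z with hy
  set gW : Matrix.specialUnitaryGroup (Fin 2) ℂ := W ⟨z, ν⟩ with hgW
  set Jf : Matrix.specialUnitaryGroup (Fin 2) ℂ := faceSec V ⟨z, ν⟩ with hJf
  set G : Matrix.specialUnitaryGroup (Fin 2) ℂ := gW * Jf⁻¹ with hG
  set g : Matrix (Fin 2) (Fin 2) ℂ := ((gW : Matrix.specialUnitaryGroup (Fin 2) ℂ) : Matrix (Fin 2) (Fin 2) ℂ) with hg
  set J : Matrix (Fin 2) (Fin 2) ℂ := ((Jf : Matrix.specialUnitaryGroup (Fin 2) ℂ) : Matrix (Fin 2) (Fin 2) ℂ) with hJ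
  set P₀ : Matrix (Fin 2) (Fin 2) ℂ := ((GaugeField.plaqHol W ⟨z, κ, κ', h⟩ : Matrix.specialUnitaryGroup (Fin 2) ℂ) : Matrix (Fin 2) (Fin 2) ℂ) with hP₀
  set P₁ : Matrix (Fin 2) (Fin 2) ℂ := ((GaugeField.plaqHol W ⟨z.shift ν, κ, κ', h⟩ : Matrix.specialUnitaryGroup (Fin 2) ℂ) : Matrix (Fin 2) (Fin 2) ℂ) with hP₁
  set c₀ := curv V y κ κ' with hc₀
  set c₁ := curv V (blockOf (z.shift ν)) κ κ' with hc₁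
  set Y₀ : Matrix (Fin 2) (Fin 2) ℂ := exp ((1 / (P.L : ℝ) ^ 2) • c₀) with hY₀
  set Y₁ : Matrix (Fin 2) (Fin 2) ℂ := exp ((1 / (P.L : ℝ) ^ 2) • c₁) with hY₁
  have hPY₀ : ‖P₀ - Y₀‖ ≤ K := hS ⟨z, κ, κ', h⟩
  have hPY₁ : ‖P₁ - Y₁‖ ≤ K := hS ⟨z.shift ν, κ, κ', h⟩
  have hGε : ‖((G : Matrix.specialUnitaryGroup (Fin 2) ℂ) : Matrix (Fin 2) (Fin 2) ℂ) - 1‖ ≤ ε := by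
    rw [hG, Submonoid.coe_mul, coe_inv_su2]; exact hB ⟨z, ν⟩
  -- unitarity facts
  have hJJ : star J * J = 1 := Matrix.mem_unitaryGroup_iff'.1 (Matrix.mem_specialUnitaryGroup_iff.1 Jf.2).1
  have hJJ' : J * star J = 1 := Matrix.mem_unitaryGroup_iff.1 (Matrix.mem_specialUnitaryGroup_iff.1 Jf.2).1
  have hgdec : g = ((G : Matrix.specialUnitaryGroup (Fin 2) ℂ) : Matrix (Fin 2) (Fin 2) ℂ) * J := by
    rw [hG, Submonoid.coe_mul, coe_inv_su2, mul_assoc, hJJ, mul_one]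
  -- sizes
  have hsmall₀ : ‖(1 / (P.L : ℝ) ^ 2) • c₀‖ ≤ 2 * a := by
    rw [norm_smul, Real.norm_of_nonneg (by positivity)]
    calc 1 / (P.L : ℝ) ^ 2 * ‖c₀‖ ≤ 1 * (2 * a) :=
          mul_le_mul (by rw [div_le_one (by positivity)]; nlinarith) (hc _ _ _) (norm_nonneg _) zero_le_one
      _ = 2 * a := one_mul _
  have hY₀1 : ‖Y₀ - 1‖ ≤ 4 * a := by
    refine (Literature.Analysis.Calculus.norm_exp_sub_one_le _).trans ?_
    refine (exp_sub_one_le_two_mul (norm_nonneg _) (hsmall₀.trans (by linarith))).trans ?_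
    linarith
  -- the matrix of the covariant difference
  have hlhs : (((W ⟨z, ν⟩)⁻¹ * GaugeField.plaqHol W ⟨z, κ, κ', h⟩ * W ⟨z, ν⟩ : Matrix.specialUnitaryGroup (Fin 2) ℂ) : Matrix (Fin 2) (Fin 2) ℂ) =
      star g * P₀ * g := by
    rw [Submonoid.coe_mul, Submonoid.coe_mul, coe_inv_su2]
  rw [hlhs]
  -- decomposition: `g* P₀ g − P₁ = g*(P₀ − Y₀)g + J*(G* Y₀ G − Y₀)J + (J* Y₀ J − Y₁) + (Y₁ − P₁)`
  have hdec : star g * P₀ * g - P₁ =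
      star g * (P₀ - Y₀) * g +
        star J * (star ((G : Matrix.specialUnitaryGroup (Fin 2) ℂ) : Matrix (Fin 2) (Fin 2) ℂ) * Y₀ *
          ((G : Matrix.specialUnitaryGroup (Fin 2) ℂ) : Matrix (Fin 2) (Fin 2) ℂ) - Y₀) * J +
        (star J * Y₀ * J - Y₁) + (Y₁ - P₁) := by
    rw [hgdec, star_mul]
    noncomm_ring
  rw [hdec]
  -- the four terms
  have t1 : ‖star g * (P₀ - Y₀) * g‖ ≤ K := by
    calc ‖star g * (P₀ - Y₀) * g‖ ≤ ‖star g * (P₀ - Y₀)‖ * ‖g‖ := norm_mul_le _ _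
      _ ≤ (‖star g‖ * ‖P₀ - Y₀‖) * ‖g‖ := by gcongr; exact norm_mul_le _ _
      _ ≤ (1 * K) * 1 := by
          gcongr
          · rw [norm_star]; exact norm_coe_su2_le gW
          · exact norm_coe_su2_le gW
      _ = K := by ring
  have t2 : ‖star J * (star ((G : Matrix.specialUnitaryGroup (Fin 2) ℂ) : Matrix (Fin 2) (Fin 2) ℂ) * Y₀ *
      ((G : Matrix.specialUnitaryGroup (Fin 2) ℂ) : Matrix (Fin 2) (Fin 2) ℂ) - Y₀) * J‖ ≤ 8 * a * ε := by
    have hin := norm_inv_conj_sub_le G Y₀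
    calc _ ≤ ‖star J * (star ((G : Matrix.specialUnitaryGroup (Fin 2) ℂ) : Matrix (Fin 2) (Fin 2) ℂ) * Y₀ *
          ((G : Matrix.specialUnitaryGroup (Fin 2) ℂ) : Matrix (Fin 2) (Fin 2) ℂ) - Y₀)‖ * ‖J‖ := norm_mul_le _ _
      _ ≤ (‖star J‖ * ‖star ((G : Matrix.specialUnitaryGroup (Fin 2) ℂ) : Matrix (Fin 2) (Fin 2) ℂ) * Y₀ *
          ((G : Matrix.specialUnitaryGroup (Fin 2) ℂ) : Matrix (Fin 2) (Fin 2) ℂ) - Y₀‖) * ‖J‖ := by gcongr; exact norm_mul_le _ _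
      _ ≤ (1 * (2 * ‖Y₀ - 1‖ * ‖((G : Matrix.specialUnitaryGroup (Fin 2) ℂ) : Matrix (Fin 2) (Fin 2) ℂ) - 1‖)) * 1 := by
          gcongr
          · rw [norm_star]; exact norm_coe_su2_le Jf
          · exact norm_coe_su2_le Jf
      _ ≤ 1 * (2 * (4 * a) * ε) * 1 := by gcongr
      _ = 8 * a * ε := by ring
  have t3 : ‖star J * Y₀ * J - Y₁‖ ≤ 3 * b' := by
    by_cases hex : ExitsBlock (⟨z, ν⟩ : PBond P j)
    · -- across the face: `J = V(y,ν)`, the block of `z + e_ν` is `y + e_ν`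
      have hJv : Jf = V ⟨y, ν⟩ := by rw [hJf, faceSec_of_exits V hex]
      have hblock : blockOf (z.shift ν) = y.shift ν := by rw [hy, blockOf_shift hj z ν, if_pos]; exact hex
      have hconj : star J * Y₀ * J = exp ((1 / (P.L : ℝ) ^ 2) • (star J * c₀ * J)) := by
        have hce := conj_exp Jf⁻¹ ((1 / (P.L : ℝ) ^ 2) • c₀)
        rw [coe_inv_su2, star_star] at hce
        rw [hY₀, hce, Matrix.mul_smul, Matrix.smul_mul]
      rw [hconj, hY₁]
      refine (Literature.Analysis.Complex.norm_exp_sub_exp_le _ _).trans ?_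
      have hdiff : (1 / (P.L : ℝ) ^ 2) • (star J * c₀ * J) - (1 / (P.L : ℝ) ^ 2) • c₁ = (1 / (P.L : ℝ) ^ 2) • (star J * c₀ * J - c₁) := by
        rw [smul_sub]
      have hcc' : ‖star J * c₀ * J - c₁‖ ≤ b' := by
        have hiso : star J * c₀ * J - c₁ = star J * (c₀ - (J * c₁ * star J)) * J := by
          have : star J * (J * c₁ * star J) * J = (star J * J) * c₁ * (star J * J) := by noncomm_ring
          rw [mul_sub, sub_mul, this, hJJ, one_mul, mul_one]
        rw [hiso]
        have hce := norm_conj_eq Jf⁻¹ (c₀ - J * c₁ * star J)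
        rw [coe_inv_su2, star_star] at hce
        rw [hce, ← norm_neg, neg_sub, hc₁, hblock, hJ, hJv, hc₀]
        exact hcc y ν κ κ'
      have hn1 : ‖(1 / (P.L : ℝ) ^ 2) • (star J * c₀ * J) - (1 / (P.L : ℝ) ^ 2) • c₁‖ ≤ b' := by
        rw [hdiff, norm_smul, Real.norm_of_nonneg (by positivity)]
        calc 1 / (P.L : ℝ) ^ 2 * ‖star J * c₀ * J - c₁‖ ≤ 1 * b' :=
              mul_le_mul (by rw [div_le_one (by positivity)]; nlinarith) hcc' (norm_nonneg _) zero_le_one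
          _ = b' := one_mul _
      have hm1 : ‖(1 / (P.L : ℝ) ^ 2) • (star J * c₀ * J)‖ ≤ 1 := by
        have hce := norm_conj_eq Jf⁻¹ c₀
        rw [coe_inv_su2, star_star] at hce
        rw [norm_smul, hce, ← norm_smul]; linarith
      have hm2 : ‖(1 / (P.L : ℝ) ^ 2) • c₁‖ ≤ 1 := by
        rw [norm_smul, Real.norm_of_nonneg (by positivity)]
        calc 1 / (P.L : ℝ) ^ 2 * ‖c₁‖ ≤ 1 * (2 * a) :=
              mul_le_mul (by rw [div_le_one (by positivity)]; nlinarith) (hc _ _ _) (norm_nonneg _) zero_le_one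
          _ ≤ 1 := by linarith
      have hexp : Real.exp (max ‖(1 / (P.L : ℝ) ^ 2) • (star J * c₀ * J)‖ ‖(1 / (P.L : ℝ) ^ 2) • c₁‖) ≤ 3 :=
        (Real.exp_le_exp.mpr (max_le hm1 hm2)).trans (by have := Real.exp_one_lt_d9; linarith)
      calc _ ≤ b' * 3 := mul_le_mul hn1 hexp (by positivity) hb'
        _ = 3 * b' := by ring
    · -- inside the block: `J = 1`, same block
      have hJ1 : J = 1 := by rw [hJ, hJf, faceSec_of_not_exits V hex]; rfl
      have hblock : blockOf (z.shift ν) = y := by rw [hy, blockOf_shift hj z ν, if_neg]; exact hex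
      have : Y₁ = Y₀ := by rw [hY₁, hY₀, hc₁, hc₀, hblock]
      rw [hJ1, star_one, one_mul, mul_one, this, sub_self, norm_zero]; positivity
  have t4 : ‖Y₁ - P₁‖ ≤ K := by rw [← norm_neg, neg_sub]; exact hPY₁
  calc _ ≤ ‖star g * (P₀ - Y₀) * g‖ +
        ‖star J * (star ((G : Matrix.specialUnitaryGroup (Fin 2) ℂ) : Matrix (Fin 2) (Fin 2) ℂ) * Y₀ *
          ((G : Matrix.specialUnitaryGroup (Fin 2) ℂ) : Matrix (Fin 2) (Fin 2) ℂ) - Y₀) * J‖ +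
        ‖star J * Y₀ * J - Y₁‖ + ‖Y₁ - P₁‖ := norm_add₄_le
    _ ≤ K + 8 * a * ε + 3 * b' + K := by linarith
    _ = 2 * K + 8 * a * ε + 3 * b' := by ring

/-- **CURVATURE GRADIENTS FROM THE BLOCK STRUCTURE.**  Let `V` be a coarse `SU(2)` field with `‖F_{κλ}(y)‖ ≤ 2a` (`a ≤ 1/4`) and
covariant-constancy defect `≤ b′`, and `W` a fine field with (S) `‖W(∂q) − exp(F(blockOf q₋)/L²)‖ ≤ K` for all fine plaquettes and
(B) `‖W(b)·(faceSec V (b))* − 1‖ ≤ ε` for all fine bonds.  Then every backward covariant derivative of every plaquette field of `W` is at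
most `2K + 8aε + 3b′` (both orientations; [Balaban1985RegularSpaces] (1.1) via the dictionary `AvgCurvGrad.covDerivT_plaqFT_shift_eq(_inv)`).
[cite: Balaban1985RegularSpaces, (1.1) p.76] -/
theorem norm_covDerivT_plaqFT_le_of_structure (hj : j + 1 ≤ P.m + P.K) (V : GaugeField P (j+1) (Matrix.specialUnitaryGroup (Fin 2) ℂ))
    (W : GaugeField P j (Matrix.specialUnitaryGroup (Fin 2) ℂ)) {a b' K ε : ℝ} (ha4 : a ≤ 1 / 4) (hK : 0 ≤ K) (hb' : 0 ≤ b')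
    (hc : ∀ (y : Site P (j+1)) (ρ μ : Fin P.d), ‖curv V y ρ μ‖ ≤ 2 * a)
    (hcc : ∀ (y : Site P (j+1)) (κ ρ μ : Fin P.d),
      ‖((V ⟨y, κ⟩ : Matrix.specialUnitaryGroup (Fin 2) ℂ) : Matrix (Fin 2) (Fin 2) ℂ) * curv V (y.shift κ) ρ μ *
          star ((V ⟨y, κ⟩ : Matrix.specialUnitaryGroup (Fin 2) ℂ) : Matrix (Fin 2) (Fin 2) ℂ) - curv V y ρ μ‖ ≤ b')
    (hS : ∀ q : Plaq P j, ‖((GaugeField.plaqHol W q : Matrix.specialUnitaryGroup (Fin 2) ℂ) : Matrix (Fin 2) (Fin 2) ℂ) -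
        exp ((1 / (P.L : ℝ) ^ 2) • curv V (blockOf q.src) q.μ q.ν)‖ ≤ K)
    (hB : ∀ b : PBond P j, ‖((W b : Matrix.specialUnitaryGroup (Fin 2) ℂ) : Matrix (Fin 2) (Fin 2) ℂ) *
        star ((faceSec V b : Matrix.specialUnitaryGroup (Fin 2) ℂ) : Matrix (Fin 2) (Fin 2) ℂ) - 1‖ ≤ ε)
    (x : Site P j) (ν κ κ' : Fin P.d) (hκ : κ ≠ κ') :
    ‖covDerivT 1 (unitsField (toUField W)) ν (plaqFT (unitsField (toUField W)) κ κ') x‖ ≤ 2 * K + 8 * a * ε + 3 * b' := by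
  rcases lt_or_gt_of_ne hκ with hlt | hgt
  · rw [← shift_unshift' x ν, covDerivT_plaqFT_shift_eq W ν hlt]
    exact norm_covDiff_le_of_structure hj V W ha4 hK hb' hc hcc hS hB _ _ hlt
  · rw [← shift_unshift' x ν, covDerivT_plaqFT_shift_eq_inv W ν hgt]
    exact (covDiff_inv_le _ _ _).trans (norm_covDiff_le_of_structure hj V W ha4 hK hb' hc hcc hS hB _ _ hgt)

/-- **THE INTERPOLATION ITSELF SATISFIES (B)** with `ε = 2da` (for `(4d+2)a ≤ 1`): `interp V (b) = e^{s(b)B}·faceSec V (b)` and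
`‖e^{s(b)B} − 1‖ ≤ 2‖s(b)B‖ ≤ 2da`. [cite: King1986, (A.5) p.676] -/
theorem norm_interp_mul_star_faceSec_sub_one_le (V : GaugeField P (j+1) (Matrix.specialUnitaryGroup (Fin 2) ℂ)) {a : ℝ}
    (ha1 : (4 * (P.d : ℝ) + 2) * a ≤ 1) (hc : ∀ (y : Site P (j+1)) (ρ μ : Fin P.d), ‖curv V y ρ μ‖ ≤ 2 * a) (b : PBond P j) :
    ‖((interp V b : Matrix.specialUnitaryGroup (Fin 2) ℂ) : Matrix (Fin 2) (Fin 2) ℂ) *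
        star ((faceSec V b : Matrix.specialUnitaryGroup (Fin 2) ℂ) : Matrix (Fin 2) (Fin 2) ℂ) - 1‖ ≤ 2 * (P.d : ℝ) * a := by
  have hd1 : (1 : ℝ) ≤ P.d := by exact_mod_cast P.hd
  have ha : 0 ≤ a := by
    have := hc (blockOf b.src) b.dir b.dir; have := norm_nonneg (curv V (blockOf b.src) b.dir b.dir); linarith
  have hJJ : ((faceSec V b : Matrix.specialUnitaryGroup (Fin 2) ℂ) : Matrix (Fin 2) (Fin 2) ℂ) *
      star ((faceSec V b : Matrix.specialUnitaryGroup (Fin 2) ℂ) : Matrix (Fin 2) (Fin 2) ℂ) = 1 :=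
    Matrix.mem_unitaryGroup_iff.1 (Matrix.mem_specialUnitaryGroup_iff.1 (faceSec V b).2).1
  rw [interp_apply, Submonoid.coe_mul, coe_modelFactor, mul_assoc, hJJ, mul_one]
  have hpot : ‖wt b • pot V b.src b.dir‖ ≤ (P.d : ℝ) * a :=
    (norm_wt_smul_pot_le V b b.src b.dir (fun ρ => hc _ ρ _)).trans (by linarith)
  have hsmall : ‖wt b • pot V b.src b.dir‖ ≤ 1 / 2 := hpot.trans (by nlinarith)
  calc ‖exp (wt b • pot V b.src b.dir) - 1‖ ≤ Real.exp ‖wt b • pot V b.src b.dir‖ - 1 := Literature.Analysis.Calculus.norm_exp_sub_one_le _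
    _ ≤ 2 * ‖wt b • pot V b.src b.dir‖ := exp_sub_one_le_two_mul (norm_nonneg _) hsmall
    _ ≤ 2 * ((P.d : ℝ) * a) := by gcongr
    _ = 2 * (P.d : ℝ) * a := by ring

end Summit.QuantumFields.YangMills.Theorems.SmoothLiftInterp

end
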